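import Mathlib

/-!
# Imbrie (2016), the three-spin block: the x-polarised FLAT PAIR on the diagonal `t₁ = t₃`

[cite: ImbrieJSP2016, eq. (1.1), assumption LLA(ν, C)]  Repair cell b2b-imbrie, LLA.md block O,
O5(i).  In the three-spin block `H = D + t₁X₁ + t₂X₂ + t₃X₃` (D = diagonal landscape
`E_σ = c₀ + h₁σ₁ + h₂σ₂ + h₃σ₃ + J₁σ₁σ₂ + J₂σ₂σ₃`, shift adjoined) the x-polarised pair
`Ψ₁ = |+x, s_x, −x⟩`, `Ψ₂ = |−x, s_x, +x⟩` (un-normalised, entries ±1) satisfies: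
* it is an eigenpair of the transverse part with energies `t₁ + s t₂ − t₃`, `−t₁ + s t₂ + t₃`,
  degenerate iff `t₁ = t₃` (for every `t₂`);
* FIRST-ORDER FLATNESS: `⟪Ψ₁, D Ψ₂⟫ = 0` (the σ₁σ₃-Fourier coefficient of the landscape
  vanishes) and `⟪Ψ₁, D Ψ₁⟫ = ⟪Ψ₂, D Ψ₂⟫`;
* CELL FLATNESS: every bond-1 cell projection `Π_{(σ₁,σ₂)}` and every bond-2 cell projection
  `Π_{(σ₂,σ₃)}` is scalar on `span{Ψ₁, Ψ₂}` (equal diagonal values, zero cross term).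
Hence on `{t₁ = t₃}` no one-cell variation of the landscape separates this resonant pair at
first order (the obstruction behind the t-averaged form of the residual (R3); evidence in
NUMERICS-seat1-g7 §C2).  Finite identities over the 8 configurations; no analysis.
-/

namespace Literature.MathematicalPhysics.QuantumLattice.Imbrie2016

open Finset BigOperators

namespace FlatPair

/-- [cite: ImbrieJSP2016, eq. (1.1)] spin value of a basis index: `0 ↦ +1`, `1 ↦ −1`. -/
def sgn (a : Fin 2) : ℝ := if a = 0 then 1 else -1

/-- [cite: ImbrieJSP2016, eq. (1.1)] three-spin kets as real functions of the three basis indices. -/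
abbrev Ket := Fin 2 → Fin 2 → Fin 2 → ℝ

/-- [cite: ImbrieJSP2016, eq. (1.1)] the transverse part `t₁X₁ + t₂X₂ + t₃X₃`. -/
def transverse (t₁ t₂ t₃ : ℝ) (ψ : Ket) : Ket :=
  fun a b c => t₁ * ψ a.rev b c + t₂ * ψ a b.rev c + t₃ * ψ a b c.rev

/-- [cite: ImbrieJSP2016, eq. (1.1)] the landscape (diagonal part, shift `c₀` adjoined). -/
def landscape (c₀ h₁ h₂ h₃ J₁ J₂ : ℝ) (a b c : Fin 2) : ℝ :=
  c₀ + h₁ * sgn a + h₂ * sgn b + h₃ * sgn c + J₁ * sgn a * sgn b + J₂ * sgn b * sgn c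

/-- [cite: ImbrieJSP2016, eq. (1.1)] multiplication by the landscape. -/
def diag (c₀ h₁ h₂ h₃ J₁ J₂ : ℝ) (ψ : Ket) : Ket :=
  fun a b c => landscape c₀ h₁ h₂ h₃ J₁ J₂ a b c * ψ a b c

/-- [cite: ImbrieJSP2016, eq. (1.1)] real inner product on kets. -/
def inner (φ ψ : Ket) : ℝ := ∑ a, ∑ b, ∑ c, φ a b c * ψ a b c

/-- [cite: ImbrieJSP2016, eq. (1.1)] the `X₂`-eigenstate of the middle spin with eigenvalue `sgn s`. -/
def midX (s : Fin 2) (b : Fin 2) : ℝ := if s = 0 then 1 else sgn b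

/-- [cite: ImbrieJSP2016, eq. (1.1)] `Ψ₁ = |+x⟩ ⊗ |s_x⟩ ⊗ |−x⟩` (entries ±1). -/
def Ψ₁ (s : Fin 2) : Ket := fun _ b c => midX s b * sgn c

/-- [cite: ImbrieJSP2016, eq. (1.1)] `Ψ₂ = |−x⟩ ⊗ |s_x⟩ ⊗ |+x⟩` (entries ±1). -/
def Ψ₂ (s : Fin 2) : Ket := fun a b _ => sgn a * midX s b

/-- [cite: ImbrieJSP2016, eq. (1.1)] `Ψ₁` is an eigenvector of the transverse part with energy `t₁ + (sgn s) t₂ − t₃`. -/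
theorem transverse_Ψ₁ (t₁ t₂ t₃ : ℝ) (s : Fin 2) :
    transverse t₁ t₂ t₃ (Ψ₁ s) = fun a b c => (t₁ + sgn s * t₂ - t₃) * Ψ₁ s a b c := by
  funext a b c
  fin_cases s <;> fin_cases a <;> fin_cases b <;> fin_cases c <;>
    simp [transverse, Ψ₁, midX, sgn, Fin.rev] <;> ring

/-- [cite: ImbrieJSP2016, eq. (1.1)] `Ψ₂` is an eigenvector of the transverse part with energy `−t₁ + (sgn s) t₂ + t₃`. -/
theorem transverse_Ψ₂ (t₁ t₂ t₃ : ℝ) (s : Fin 2) :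
    transverse t₁ t₂ t₃ (Ψ₂ s) = fun a b c => (-t₁ + sgn s * t₂ + t₃) * Ψ₂ s a b c := by
  funext a b c
  fin_cases s <;> fin_cases a <;> fin_cases b <;> fin_cases c <;>
    simp [transverse, Ψ₂, midX, sgn, Fin.rev] <;> ring

/-- [cite: ImbrieJSP2016, eq. (1.1)] the pair is degenerate for the transverse part iff `t₁ = t₃` (for every `t₂`, `s`). -/
theorem degenerate_iff (t₁ t₂ t₃ : ℝ) (s : Fin 2) :
    t₁ + sgn s * t₂ - t₃ = -t₁ + sgn s * t₂ + t₃ ↔ t₁ = t₃ := by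
  constructor <;> intro h <;> linarith

/-- [cite: ImbrieJSP2016, eq. (1.1)] the pair is orthogonal, each member of squared norm 8. -/
theorem inner_Ψ₁_Ψ₂ (s : Fin 2) :
    inner (Ψ₁ s) (Ψ₂ s) = 0 ∧ inner (Ψ₁ s) (Ψ₁ s) = 8 ∧ inner (Ψ₂ s) (Ψ₂ s) = 8 := by
  fin_cases s <;> simp [inner, Ψ₁, Ψ₂, midX, sgn, Fin.sum_univ_two] <;> norm_num

/-- [cite: ImbrieJSP2016, eq. (1.1)] FIRST-ORDER FLATNESS, off-diagonal: the landscape does not couple the pair,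
`⟪Ψ₁, D Ψ₂⟫ = 0` (it is `Σ_σ E_σ σ₁σ₃`, the vanishing σ₁σ₃-coefficient). -/
theorem firstOrder_coupling_zero (c₀ h₁ h₂ h₃ J₁ J₂ : ℝ) (s : Fin 2) :
    inner (Ψ₁ s) (diag c₀ h₁ h₂ h₃ J₁ J₂ (Ψ₂ s)) = 0 := by
  fin_cases s <;> simp [inner, diag, landscape, Ψ₁, Ψ₂, midX, sgn, Fin.sum_univ_two] <;> ring

/-- [cite: ImbrieJSP2016, eq. (1.1)] FIRST-ORDER FLATNESS, diagonal: both first-order shifts equal `8 c₀` (the landscape mean). -/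
theorem firstOrder_shifts_equal (c₀ h₁ h₂ h₃ J₁ J₂ : ℝ) (s : Fin 2) :
    inner (Ψ₁ s) (diag c₀ h₁ h₂ h₃ J₁ J₂ (Ψ₁ s)) = 8 * c₀ ∧
      inner (Ψ₂ s) (diag c₀ h₁ h₂ h₃ J₁ J₂ (Ψ₂ s)) = 8 * c₀ := by
  fin_cases s <;> refine ⟨?_, ?_⟩ <;>
    simp [inner, diag, landscape, Ψ₁, Ψ₂, midX, sgn, Fin.sum_univ_two] <;> ring

/-- [cite: ImbrieJSP2016, eq. (1.1)] CELL FLATNESS, bond-1 cells `(σ₁,σ₂) = (r₁,r₂)`: the cell projection has zero cross term and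
equal diagonal values (`= 2`) on the pair. -/
theorem bondOneCell_flat (s r₁ r₂ : Fin 2) :
    (∑ c, Ψ₁ s r₁ r₂ c * Ψ₂ s r₁ r₂ c) = 0 ∧
      (∑ c, Ψ₁ s r₁ r₂ c * Ψ₁ s r₁ r₂ c) = 2 ∧ (∑ c, Ψ₂ s r₁ r₂ c * Ψ₂ s r₁ r₂ c) = 2 := by
  fin_cases s <;> fin_cases r₁ <;> fin_cases r₂ <;>
    simp [Ψ₁, Ψ₂, midX, sgn, Fin.sum_univ_two] <;> norm_num

/-- [cite: ImbrieJSP2016, eq. (1.1)] CELL FLATNESS, bond-2 cells `(σ₂,σ₃) = (r₂,r₃)`: the cell projection has zero cross term and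
equal diagonal values (`= 2`) on the pair. -/
theorem bondTwoCell_flat (s r₂ r₃ : Fin 2) :
    (∑ a, Ψ₁ s a r₂ r₃ * Ψ₂ s a r₂ r₃) = 0 ∧
      (∑ a, Ψ₁ s a r₂ r₃ * Ψ₁ s a r₂ r₃) = 2 ∧ (∑ a, Ψ₂ s a r₂ r₃ * Ψ₂ s a r₂ r₃) = 2 := by
  fin_cases s <;> fin_cases r₂ <;> fin_cases r₃ <;>
    simp [Ψ₁, Ψ₂, midX, sgn, Fin.sum_univ_two] <;> norm_num

/-- [cite: ImbrieJSP2016, eq. (1.1)] Hellmann–Feynman form of cell flatness: for ANY state `φ = α Ψ₁ + β Ψ₂` of the pair and any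
bond-1 cell, the cell weight `Σ_c φ(r₁,r₂,c)²` equals `2 (α² + β²)` — independent of the mixing, so
every one-cell energy moves both levels of the pair at the same first-order speed. -/
theorem bondOneCell_weight_constant (s r₁ r₂ : Fin 2) (α β : ℝ) :
    (∑ c, (α * Ψ₁ s r₁ r₂ c + β * Ψ₂ s r₁ r₂ c) ^ 2) = 2 * (α ^ 2 + β ^ 2) := by
  fin_cases s <;> fin_cases r₁ <;> fin_cases r₂ <;>
    simp [Ψ₁, Ψ₂, midX, sgn, Fin.sum_univ_two] <;> ring

/-- [cite: ImbrieJSP2016, eq. (1.1)] the same for bond-2 cells. -/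
theorem bondTwoCell_weight_constant (s r₂ r₃ : Fin 2) (α β : ℝ) :
    (∑ a, (α * Ψ₁ s a r₂ r₃ + β * Ψ₂ s a r₂ r₃) ^ 2) = 2 * (α ^ 2 + β ^ 2) := by
  fin_cases s <;> fin_cases r₂ <;> fin_cases r₃ <;>
    simp [Ψ₁, Ψ₂, midX, sgn, Fin.sum_univ_two] <;> ring

/-- [cite: ImbrieJSP2016, eq. (1.1)] CONTRAST: the analogous pair across the (1,2)-diagonal, `Φ₁ = |+x,−x,r_x⟩`, `Φ₂ = |−x,+x,r_x⟩`
(degenerate for the transverse part iff `t₁ = t₂`), is NOT flat: the landscape couples it at first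
order through the nearest-neighbour term `J₁σ₁σ₂` (`⟪Φ₁, D Φ₂⟫ = 8 J₁`), and the bond-1 cell
projections have cross term `± 2`.  The flat direction `t₁ = t₃` is exactly the missing
next-nearest-neighbour character σ₁σ₃ of [ImbrieJSP2016, eq. (1.1)]. -/
def Φ₁ (r : Fin 2) : Ket := fun _ b c => sgn b * midX r c

/-- [cite: ImbrieJSP2016, eq. (1.1)] see `Φ₁`. -/
def Φ₂ (r : Fin 2) : Ket := fun a _ c => sgn a * midX r c

/-- [cite: ImbrieJSP2016, eq. (1.1)] transverse energies of the (1,2)-diagonal pair: `t₁ − t₂ + r t₃`, `−t₁ + t₂ + r t₃`. -/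
theorem transverse_Φ (t₁ t₂ t₃ : ℝ) (r : Fin 2) :
    transverse t₁ t₂ t₃ (Φ₁ r) = (fun a b c => (t₁ - t₂ + sgn r * t₃) * Φ₁ r a b c) ∧
      transverse t₁ t₂ t₃ (Φ₂ r) = fun a b c => (-t₁ + t₂ + sgn r * t₃) * Φ₂ r a b c := by
  refine ⟨?_, ?_⟩ <;> funext a b c <;>
    fin_cases r <;> fin_cases a <;> fin_cases b <;> fin_cases c <;>
    simp [transverse, Φ₁, Φ₂, midX, sgn, Fin.rev] <;> ring

/-- [cite: ImbrieJSP2016, eq. (1.1)] the landscape couples the (1,2)-diagonal pair at first order: `⟪Φ₁, D Φ₂⟫ = 8 J₁`. -/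
theorem firstOrder_coupling_Φ (c₀ h₁ h₂ h₃ J₁ J₂ : ℝ) (r : Fin 2) :
    inner (Φ₁ r) (diag c₀ h₁ h₂ h₃ J₁ J₂ (Φ₂ r)) = 8 * J₁ := by
  fin_cases r <;> simp [inner, diag, landscape, Φ₁, Φ₂, midX, sgn, Fin.sum_univ_two] <;> ring

/-- [cite: ImbrieJSP2016, eq. (1.1)] bond-1 cell projections are NOT scalar on the (1,2)-diagonal pair: cross term `2 σ₁ σ₂`. -/
theorem bondOneCell_cross_Φ (r r₁ r₂ : Fin 2) :
    (∑ c, Φ₁ r r₁ r₂ c * Φ₂ r r₁ r₂ c) = 2 * sgn r₁ * sgn r₂ := by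
  fin_cases r <;> fin_cases r₁ <;> fin_cases r₂ <;>
    simp [Φ₁, Φ₂, midX, sgn, Fin.sum_univ_two] <;> norm_num

end FlatPair

end Literature.MathematicalPhysics.QuantumLattice.Imbrie2016
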